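import Mathlib
import HarnessLib
import Summits.HubbardSuperconductivity.HubbardSuperconductivity.Theorems.KLProgrammeKLRegimeEngineV8RaiseDoors
import Summits.HubbardSuperconductivity.HubbardSuperconductivity.Theorems.KLProgrammeKLRegimeEngineV8E5Share2
import Summits.HubbardSuperconductivity.HubbardSuperconductivity.Theorems.KLProgrammeKLRegimeEngineV8TowerCEDefs

/-!
# K3 ENGINE package, `Q`-level v9: `klEngQ9 P R := ((klEngQ8 P R).withCR (max (klEngQ8 P R).CR (klE5Raise2 P R))).withCE e_T`
# (token #13 `klEngQ7 ↦ klEngQ9` of the v2 re-registration of the 20437 engine-flow skeleton under EVERY table — plan g19 (R57) K7(b) / (R57a)(1))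

Cell `gate-hubbard-kl`, seat hubbard-kl-k3c2-p1 (the k3c2-p1 lineage owns the `Q`-Defs chain …DefsQ2/…/DefsQ8 and token #13).

TABLE OF RECORD: **B′** (pen plan g19 (R59v)(A), 2026-08-27, on the E1 successor's early word E1-WORD-g7 88a3b773402d9385: `e_T := max (klEngQ8 P R).CE (klTowerCE P R)`,
`klTowerCE P R` = E1's DEFERRED tower-table constant — the first component of the dite package `klTowerPkg P R` over `∃ e, IsTowerPkg e ∧ TowerNormsStep P R (klEngQ8 P R) e.1 e.2`,
…EngineV8TowerCEDefs (E1 lineage, p561840), keyed `(P, R)` with geometry pinned at the FIXED token #15 `klEngGeo8`, reading NO field of any `Q` ⇒ acyclic with `klEngQ9`).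
File order of record ((R59v)(A)(iii)): …TowerCEDefs → THIS FILE → …DefsU11 (row `⊓ klTowerU P R (klEngQ9 P R) cc`) → the v2-(a) re-closer → the (X) closer.

WHY ((R57) K7(b)).  The successor E.5 share of class #3 (`klE5Raise2 P R`, p5's `…EngineV8E5Share2`, under every table) is read by the engine package's
`CR`; the successor class Steps (`LevelsUStep2`, `E5ShareStep2`, `IsoTupleLineStepW`, `PairTransferStep′` [, `TwoLegMomentsStep′`]) quantify their history over
`∀ Q, (klEngQ7 P R).IsRaiseOf Q →` (`…EngineV8Raise`), so all the composition and the (a)/(M)/(C) re-closers need from this module is ONE definition and its rows: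

* §1 **`klEngQ9 P R`**, `klEngQ9_eq`, `klEngQ9_CR`, `klEngQ9_CE`, the order rows `klEngQ8_CR_le_klEngQ9_CR` (= `klEngQ9_CR_ge`), `klEngQ7_CR_le_klEngQ9_CR`,
  **`klE5Raise2_le_klEngQ9_CR`**, `klE5Raise_le_klEngQ9_CR`, `klEngQ8_CE_le_klEngQ9_CE`, `klEngQ7_CE_le_klEngQ9_CE`; the raise rows
  `isRaiseOf_klEngQ9_klEngQ8 : (klEngQ8 P R).IsRaiseOf (klEngQ9 P R)` and **`isRaiseOf_klEngQ9 : (klEngQ7 P R).IsRaiseOf (klEngQ9 P R)`** (the `hQ` of every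
  successor Step at `Q := klEngQ9 P R`, and the `hQT` of `stub_engine_scale0_klEng8_raise klEngQ9`), `klEngQ9_wf`, the pinned rows `S'`, `c0`, `cE4`, `Bf`,
  `SL`, `CL`, `L0`, `M0` (`rfl` against `klEngQ7`; the GQJ shell of the (M)/(C) re-closers reads them), `klEngQ9_CL_apply`, `klEngQ9_eq_raise`,
  `deltaUV_absorbed9`, the `CE`-threshold riders (`klWtCE_le_klEngQ9_CE`, `klE1CE_le_klEngQ9_CE`, `klCE6_le_klEngQ9_CE`, `klEngQ6_CE_le_klEngQ9_CE`);
* §2 the instantiated doors `klEngQ8 ⟶ klEngQ9` that hold under EVERY table (raise-invariant readers: `twoLegReadJetsF_klEngQ9_iff` (`S'`),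
  `engineFirstMoments_klEngQ9_iff` (`cE4`), `twoLegVolumeRateF_zero_klEngQ9_iff` (`M0`, `CL`); the `CR`-monotone value clauses via the …DefsQ8 §1 doors at
  `r := (klEngQ9 P R).CR` composed with the `CE` re-read; the `CE`-readers (E1-v4)/(E1-F)/weighted levels/engine slot/`histV17F2` lift by
  `CE`-MONOTONICITY — under table B′ `CE` moves, so there are no `CE`-`Iff.rfl` doors).  The (b) v2 closer-of-record reads from here exactly
  `isRaiseOf_klEngQ9_klEngQ8` and `klTowerCE_le_klEngQ9_CE` (its `Q₀.IsRaiseOf Q` / `CE ≤ Q.CE` at `Q := klEngQ9 P R`).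

NOT here: the U-door `klEngU₀11` (…DefsU11, reads `klCUu2 P R (klEngQ7 P R) (klEngQ9 P R) cc`, `klE5ShareU2 P R (klEngQ9 P R) cc`, …), the v2-(a) re-closer
(`stub_engine_scale0_klEng8_raise klEngQ9 isRaiseOf_klEngQ9` + the #14/#16 binder lines).  Registrant token #13: `klEngQ7 ↦ klEngQ9` (+ `klEngQ7_wf ↦ klEngQ9_wf`,
this import).  Definitions with bodies + order lemmas only; nothing about the model is asserted; nothing asserts superconductivity.
-/

noncomputable section

namespace Summit.HubbardSuperconductivity.HubbardSuperconductivity.Theorems.EngineV8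

set_option linter.dupNamespace false -- summit = problem name (single-conjunct summit), D-0017

open Real Finset Literature.MathematicalPhysics.QuantumLattice Literature.Probability.LatticeModels
open Summit.HubbardSuperconductivity.HubbardSuperconductivity.Theorems.KLRegimeSplit
open Summit.HubbardSuperconductivity.HubbardSuperconductivity.Theorems.KLProgrammeLegKernels

/-! ## §1 The package `klEngQ9` -/

/-- **`klEngQ9CE P R` — the tree-expansion constant `e_T` of token #13** (TABLE B′: `max (klEngQ8 P R).CE (klTowerCE P R)`). -/
def klEngQ9CE (P : SplitConsts) (R : RenConsts) : ℝ := max (klEngQ8 P R).CE (klTowerCE P R)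

/-- `(klEngQ8 P R).CE ≤ klEngQ9CE P R` (the only property of `e_T` the rows below read). -/
theorem klEngQ8_CE_le_klEngQ9CE (P : SplitConsts) (R : RenConsts) : (klEngQ8 P R).CE ≤ klEngQ9CE P R := le_max_left _ _

/-- `klTowerCE P R ≤ klEngQ9CE P R` — the tower's table fits under token #13's `CE` (the CE-fit row `klCU2 … p ≤ (klEngQ9 P R).CE^p` starts here). -/
theorem klTowerCE_le_klEngQ9CE (P : SplitConsts) (R : RenConsts) : klTowerCE P R ≤ klEngQ9CE P R := le_max_right _ _

/-- **`klEngQ9 P R` — the engine-flow package's `Q`, v9 (token #13 under every table)**: `klEngQ8 P R` with `CR := max (klEngQ8 P R).CR (klE5Raise2 P R)`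
(the successor E.5 share of class #3) and `CE := klEngQ9CE P R` (`e_T`), NOTHING else moved. -/
def klEngQ9 (P : SplitConsts) (R : RenConsts) : EngConsts :=
  ((klEngQ8 P R).withCR (max (klEngQ8 P R).CR (klE5Raise2 P R))).withCE (klEngQ9CE P R)

section Rows

variable (P : SplitConsts) (R : RenConsts)

/-- `klEngQ9 P R = ((klEngQ8 P R).withCR (max (klEngQ8 P R).CR (klE5Raise2 P R))).withCE (klEngQ9CE P R)` (`rfl`). -/
theorem klEngQ9_eq : klEngQ9 P R = ((klEngQ8 P R).withCR (max (klEngQ8 P R).CR (klE5Raise2 P R))).withCE (klEngQ9CE P R) := rfl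

/-- `(klEngQ9 P R).CR = max (klEngQ8 P R).CR (klE5Raise2 P R)`. -/
theorem klEngQ9_CR : (klEngQ9 P R).CR = max (klEngQ8 P R).CR (klE5Raise2 P R) := rfl

/-- `(klEngQ9 P R).CE = klEngQ9CE P R`. -/
theorem klEngQ9_CE_eq : (klEngQ9 P R).CE = klEngQ9CE P R := rfl

/-- **`(klEngQ8 P R).CR ≤ (klEngQ9 P R).CR`** (`klEngQ9_CR_ge` of the sheet) — the lift input of every conclusion-side `CR`-reader. -/
theorem klEngQ8_CR_le_klEngQ9_CR : (klEngQ8 P R).CR ≤ (klEngQ9 P R).CR := le_max_left _ _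

/-- `(klEngQ7 P R).CR ≤ (klEngQ9 P R).CR`. -/
theorem klEngQ7_CR_le_klEngQ9_CR : (klEngQ7 P R).CR ≤ (klEngQ9 P R).CR := (klEngQ7_CR_le_klEngQ8_CR P R).trans (klEngQ8_CR_le_klEngQ9_CR P R)

/-- **`klE5Raise2 P R ≤ (klEngQ9 P R).CR`** — the successor E.5 share sits inside the v9 cubic budget (the `hCC` of `E5ShareStep2.mono` / the (c) closer). -/
theorem klE5Raise2_le_klEngQ9_CR : klE5Raise2 P R ≤ (klEngQ9 P R).CR := le_max_right _ _

/-- `klE5Raise P R ≤ (klEngQ9 P R).CR` (the rev-1 share rides). -/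
theorem klE5Raise_le_klEngQ9_CR : klE5Raise P R ≤ (klEngQ9 P R).CR := (klE5Raise_le_klEngQ8_CR P R).trans (klEngQ8_CR_le_klEngQ9_CR P R)

/-- **`(klEngQ8 P R).CE ≤ (klEngQ9 P R).CE`** (every table). -/
theorem klEngQ8_CE_le_klEngQ9_CE : (klEngQ8 P R).CE ≤ (klEngQ9 P R).CE := klEngQ8_CE_le_klEngQ9CE P R

/-- `(klEngQ7 P R).CE ≤ (klEngQ9 P R).CE`. -/
theorem klEngQ7_CE_le_klEngQ9_CE : (klEngQ7 P R).CE ≤ (klEngQ9 P R).CE := (klEngQ8_CE P R).ge.trans (klEngQ8_CE_le_klEngQ9_CE P R)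

/-- `klTowerCE P R ≤ (klEngQ9 P R).CE`. -/
theorem klTowerCE_le_klEngQ9_CE : klTowerCE P R ≤ (klEngQ9 P R).CE := klTowerCE_le_klEngQ9CE P R

/-- **`klEngQ9 P R` is a raise of `klEngQ8 P R`** (`CR` by the E.5 share, `CE` to `e_T`). -/
theorem isRaiseOf_klEngQ9_klEngQ8 : (klEngQ8 P R).IsRaiseOf (klEngQ9 P R) :=
  EngConsts.isRaiseOf_withCR_withCE (le_max_left _ _) (klEngQ8_CE_le_klEngQ9CE P R)

/-- **TOKEN #13 IS A RAISE OF THE TABLE KEY: `(klEngQ7 P R).IsRaiseOf (klEngQ9 P R)`** — the `hQ` of every successor class Step at `Q := klEngQ9 P R`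
(K2 composition) and the `hQT` of `stub_engine_scale0_klEng8_raise klEngQ9` (the v2-(a) re-closer). -/
theorem isRaiseOf_klEngQ9 : (klEngQ7 P R).IsRaiseOf (klEngQ9 P R) := (isRaiseOf_klEngQ8 P R).trans (isRaiseOf_klEngQ9_klEngQ8 P R)

/-- The family form the re-closers take: `∀ P R, (klEngQ7 P R).IsRaiseOf (klEngQ9 P R)`. -/
theorem isRaiseOf_klEngQ9_family : ∀ (P : SplitConsts) (R : RenConsts), (klEngQ7 P R).IsRaiseOf (klEngQ9 P R) := isRaiseOf_klEngQ9

/-- **`klEngQ9 P R` is well formed** (token line `klEngQ7_wf ↦ klEngQ9_wf`). -/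
theorem klEngQ9_wf : (klEngQ9 P R).WF := (isRaiseOf_klEngQ9 P R).wf (klEngQ7_wf P R)

/-- `0 ≤ (klEngQ9 P R).CE`. -/
theorem klEngQ9_CE_nonneg : 0 ≤ (klEngQ9 P R).CE := (klEngQ9_wf P R).1

/-- `0 ≤ (klEngQ9 P R).CR`. -/
theorem klEngQ9_CR_nonneg : 0 ≤ (klEngQ9 P R).CR := (klEngQ9_wf P R).2.1

/-- `klWtCE R ≤ (klEngQ9 P R).CE` (the scale-`0` weighted-level threshold rides). -/
theorem klWtCE_le_klEngQ9_CE : klWtCE R ≤ (klEngQ9 P R).CE := (klWtCE_le_klEngQ8_CE P R).trans (klEngQ8_CE_le_klEngQ9_CE P R)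

/-- `klE1CE P ≤ (klEngQ9 P R).CE` (the (E1-v4)₀ threshold rides). -/
theorem klE1CE_le_klEngQ9_CE : klE1CE P ≤ (klEngQ9 P R).CE := (klE1CE_le_klEngQ8_CE P R).trans (klEngQ8_CE_le_klEngQ9_CE P R)

/-- `klCE6 P R ≤ (klEngQ9 P R).CE` (the v6 table rides). -/
theorem klCE6_le_klEngQ9_CE : klCE6 P R ≤ (klEngQ9 P R).CE := (klCE6_le_klEngQ8_CE P R).trans (klEngQ8_CE_le_klEngQ9_CE P R)

/-- `(klEngQ6 P R).CE ≤ (klEngQ9 P R).CE`. -/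
theorem klEngQ6_CE_le_klEngQ9_CE : (klEngQ6 P R).CE ≤ (klEngQ9 P R).CE := (klEngQ6_CE_le_klEngQ8_CE P R).trans (klEngQ8_CE_le_klEngQ9_CE P R)

/-- pinned row `S'` (`rfl` against `klEngQ7`). -/
theorem klEngQ9_S' : (klEngQ9 P R).S' = (klEngQ7 P R).S' := rfl
/-- pinned row `c0`. -/
theorem klEngQ9_c0 : (klEngQ9 P R).c0 = (klEngQ7 P R).c0 := rfl
/-- pinned row `cE4`. -/
theorem klEngQ9_cE4 : (klEngQ9 P R).cE4 = (klEngQ7 P R).cE4 := rfl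
/-- pinned row `Bf`. -/
theorem klEngQ9_Bf : (klEngQ9 P R).Bf = (klEngQ7 P R).Bf := rfl
/-- pinned row `SL`. -/
theorem klEngQ9_SL : (klEngQ9 P R).SL = (klEngQ7 P R).SL := rfl
/-- pinned row `CL`. -/
theorem klEngQ9_CL : (klEngQ9 P R).CL = (klEngQ7 P R).CL := rfl
/-- pinned row `L0`. -/
theorem klEngQ9_L0 : (klEngQ9 P R).L0 = (klEngQ7 P R).L0 := rfl
/-- pinned row `M0`. -/
theorem klEngQ9_M0 : (klEngQ9 P R).M0 = (klEngQ7 P R).M0 := rfl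

/-- `(klEngQ9 P R).CL β n = (klEngQ7 P R).CL β n` (the (c)-E5 volume line `sum_CL_klEngQ7_div_le` rides token #13 verbatim). -/
theorem klEngQ9_CL_apply (β : ℝ) (n : ℕ) : (klEngQ9 P R).CL β n = (klEngQ7 P R).CL β n := rfl

/-- **The v9 package as a raise of the table key in closed form**: `klEngQ9 P R = ((klEngQ7 P R).withCR (klEngQ9 P R).CR).withCE (klEngQ9 P R).CE`
(`IsRaiseOf.eq`; the instantiation line of a `CR`/`CE`-generic closer written at `(Q₀.withCR r).withCE e`). -/
theorem klEngQ9_eq_raise : klEngQ9 P R = ((klEngQ7 P R).withCR (klEngQ9 P R).CR).withCE (klEngQ9 P R).CE := (isRaiseOf_klEngQ9 P R).eq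

/-- `deltaUV` absorption rides to v9 (`CR` only grows). -/
theorem deltaUV_absorbed9 : 32 * R.Gfr 0 + 4 * R.cr ≤ (klEngQ9 P R).CR := (deltaUV_absorbed8 P R).trans (klEngQ8_CR_le_klEngQ9_CR P R)

end Rows

/-! ## §2 The instantiated doors `klEngQ8 ⟶ klEngQ9` (via …EngineV8RaiseDoors at `isRaiseOf_klEngQ9_klEngQ8`) -/

section Model

variable {L M : ℕ} [NeZero L] [NeZero M] {G : GeoConsts} {P : SplitConsts} {R : RenConsts} {β U μ : ℝ} {K : TrigPolyC4v} {n : ℕ}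

/-- (E3a-F) at `klEngQ9` IS (E3a-F) at `klEngQ8` (`S'` pinned). -/
theorem twoLegReadJetsF_klEngQ9_iff : TwoLegReadJetsF L M G (klEngQ9 P R) β U μ n ↔ TwoLegReadJetsF L M G (klEngQ8 P R) β U μ n :=
  twoLegReadJetsF_isRaiseOf_iff (isRaiseOf_klEngQ9_klEngQ8 P R)

/-- (E4) at `klEngQ9` IS (E4) at `klEngQ8` (`cE4` pinned). -/
theorem engineFirstMoments_klEngQ9_iff :
    EngineFirstMoments L M G P (klEngQ9 P R) β U μ K n ↔ EngineFirstMoments L M G P (klEngQ8 P R) β U μ K n :=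
  engineFirstMoments_isRaiseOf_iff (isRaiseOf_klEngQ9_klEngQ8 P R)

/-- (E3f-F) at `n = 0`: `klEngQ9` IS `klEngQ8`, for any two histories (`M0`, `CL` pinned). -/
theorem twoLegVolumeRateF_zero_klEngQ9_iff (hist hist' : (L' M' : ℕ) → [NeZero L'] → [NeZero M'] → ℕ → Prop) :
    TwoLegVolumeRateF L M hist (klEngQ9 P R) β U μ 0 ↔ TwoLegVolumeRateF L M hist' (klEngQ8 P R) β U μ 0 :=
  twoLegVolumeRateF_zero_isRaiseOf_iff (isRaiseOf_klEngQ9_klEngQ8 P R) hist hist'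

omit [NeZero M] in
/-- **(E1-v4) lifts `klEngQ8 → klEngQ9`** (`P.WF`; `CE` monotone). -/
theorem kernelNormsV4_klEngQ9_of_klEngQ8 (hP : P.WF) (h : KernelNormsV4 L M P (klEngQ8 P R) β U μ K n) :
    KernelNormsV4 L M P (klEngQ9 P R) β U μ K n :=
  kernelNormsV4_of_isRaiseOf (isRaiseOf_klEngQ9_klEngQ8 P R) (klEngQ8_wf P R).1 (zero_le_one.trans hP.1) h

omit [NeZero M] in
/-- **The levelled norms lift `klEngQ8 → klEngQ9`** (`P.WF`). -/
theorem kernelNormsLevels_klEngQ9_of_klEngQ8 (hP : P.WF) (h : KernelNormsLevels L M P (klEngQ8 P R) β U μ K n) :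
    KernelNormsLevels L M P (klEngQ9 P R) β U μ K n :=
  kernelNormsLevels_of_isRaiseOf (isRaiseOf_klEngQ9_klEngQ8 P R) (klEngQ8_wf P R).1 (zero_le_one.trans hP.1) h

omit [NeZero M] in
/-- **The weighted levels at the budget lift `klEngQ8 → klEngQ9`** (`P.WF`). -/
theorem kernelNormsWt4_klWtBudget_klEngQ9_of_klEngQ8 (hP : P.WF) {j : ℕ} (h : KernelNormsWt4 L M (klWtBudget P (klEngQ8 P R) U j) β U μ K j) :
    KernelNormsWt4 L M (klWtBudget P (klEngQ9 P R) U j) β U μ K j :=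
  kernelNormsWt4_klWtBudget_of_isRaiseOf (isRaiseOf_klEngQ9_klEngQ8 P R) (klEngQ8_wf P R).1 (zero_le_one.trans hP.1) h

/-- **(E2-F2)ₙ lifts `klEngQ8 → klEngQ9`** (`P.WF`). -/
theorem pairLadderStepAtV17F2_klEngQ9_of_klEngQ8 (hP : P.WF) (h : PairLadderStepAtV17F2 L M G P (klEngQ8 P R) β U μ n) :
    PairLadderStepAtV17F2 L M G P (klEngQ9 P R) β U μ n :=
  pairLadderStepAtV17F2_of_isRaiseOf (isRaiseOf_klEngQ9_klEngQ8 P R) (zero_le_one.trans hP.1) h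

/-- **(E2″-F)ₙ lifts `klEngQ8 → klEngQ9`** (`P.WF`). -/
theorem pairValueIncrementAtV17F_klEngQ9_of_klEngQ8 (hP : P.WF) (h : PairValueIncrementAtV17F L M G P (klEngQ8 P R) β U μ n) :
    PairValueIncrementAtV17F L M G P (klEngQ9 P R) β U μ n :=
  pairValueIncrementAtV17F_of_isRaiseOf (isRaiseOf_klEngQ9_klEngQ8 P R) (zero_le_one.trans hP.1) h

/-- **(E2′-F)ₙ lifts `klEngQ8 → klEngQ9`** (`P.WF`). -/
theorem quarticValueIncrementAtV17F_klEngQ9_of_klEngQ8 (hP : P.WF) (h : QuarticValueIncrementAtV17F L M G P (klEngQ8 P R) β U μ n) :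
    QuarticValueIncrementAtV17F L M G P (klEngQ9 P R) β U μ n :=
  quarticValueIncrementAtV17F_of_isRaiseOf (isRaiseOf_klEngQ9_klEngQ8 P R) (zero_le_one.trans hP.1) h

/-- **(E2′-F UV) lifts `klEngQ8 → klEngQ9`** (`P.WF`). -/
theorem quarticValueUVAtV17F_klEngQ9_of_klEngQ8 (hP : P.WF) (h : QuarticValueUVAtV17F L M G P (klEngQ8 P R) β U μ n) :
    QuarticValueUVAtV17F L M G P (klEngQ9 P R) β U μ n :=
  quarticValueUVAtV17F_of_isRaiseOf (isRaiseOf_klEngQ9_klEngQ8 P R) (zero_le_one.trans hP.1) h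

/-- **The split slot lifts `klEngQ8 → klEngQ9`** (`P.WF`). -/
theorem betaSplitAtV17F_klEngQ9_of_klEngQ8 (hP : P.WF) (h : BetaSplitAtV17F L M G P (klEngQ8 P R) β U μ n) :
    BetaSplitAtV17F L M G P (klEngQ9 P R) β U μ n :=
  betaSplitAtV17F_of_isRaiseOf (isRaiseOf_klEngQ9_klEngQ8 P R) (zero_le_one.trans hP.1) h

/-- **The cured engine slot lifts `klEngQ8 → klEngQ9`** (`P.WF`; every scale `n`). -/
theorem engineBoundsAtV17F2_klEngQ9_of_klEngQ8 (hP : P.WF) (h : EngineBoundsAtV17F2 L M G P (klEngQ8 P R) β U μ n) :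
    EngineBoundsAtV17F2 L M G P (klEngQ9 P R) β U μ n :=
  engineBoundsAtV17F2_of_isRaiseOf (isRaiseOf_klEngQ9_klEngQ8 P R) (klEngQ8_wf P R).1 (zero_le_one.trans hP.1) h

/-- **The comparison-volume history conjunct lifts `klEngQ8 → klEngQ9`** (`P.WF`). -/
theorem histV17F2_klEngQ9_of_klEngQ8 (hP : P.WF) {j : ℕ} (h : histV17F2 L M G P (klEngQ8 P R) R β U μ j) :
    histV17F2 L M G P (klEngQ9 P R) R β U μ j :=
  histV17F2_of_isRaiseOf (isRaiseOf_klEngQ9_klEngQ8 P R) (klEngQ8_wf P R).1 (zero_le_one.trans hP.1) h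

end Model

end Summit.HubbardSuperconductivity.HubbardSuperconductivity.Theorems.EngineV8

end
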